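import Literature.AlgebraicGeometry.Milne1999.CMTypeSimpleIsogenyFactors
import Literature.AlgebraicGeometry.HodgeTheory.AbelianVarietyHOneExactness
import Literature.AlgebraicGeometry.Motives.SupersingularAbelianVariety
import HarnessLib

/-!
# Abelian subvarieties, quotients, isogeny direct summands, images and product factors of complex abelian varieties of CM-type are of CM-type

Milne, *Lefschetz motives and the Tate conjecture*, Compositio Math. 117 (1999), §2, p. 54: «an
arbitrary Abelian variety over `C` is said to be of CM-type if all its simple isogeny factors are of
CM-type»; Milne, *Abelian varieties with complex multiplication (for pedestrians)*, arXiv:math/9806172,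
p. 22: «An abelian variety `A` over a field `k` of characteristic zero is said to be of CM-type if its
Mumford–Tate group is a torus. Thus, `A` is of CM-type if, for each simple isogeny factor `B` of
`A_{k^al}`, `End⁰(B)` is a CM-field of degree `2 dim B` over `ℚ`»; Deligne, *Hodge cycles on abelian
varieties*, LNM 900 (1982), §5 p. 63: «`A` is of CM-type if and only if each `A_α` is of CM-type».
With the printed definition, CM-type visibly passes to abelian subvarieties and to quotient abelian
varieties — their simple isogeny factors are among those of `A` (Poincaré's complete reducibility and
the uniqueness of the decomposition into simple factors, Mumford §19 Thm. 1 and Cor. 1) — and a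
product `A × B` is of CM-type iff both factors are.

The tree renders «of CM-type» in the ÉTALE form `Milne1999.IsOfCMType A` (`End⁰(A)` contains a
commutative reduced `ℚ`-subalgebra of dimension `2 dim A`), proves its equivalence with Milne's
printed definition (`Milne1999.isOfCMType_iff_isOfCMTypeMilne`), its isogeny invariance
(`IsOfCMType.of_isIsogeny`), its stability under binary products (`IsOfCMType.prod`) and — so far
only for SIMPLE abelian subvarieties — its passage to abelian subvarieties
(`ComplexMultiplication.isOfCMType_of_isSimple_of_isClosedImmersion`, `hSub_simple`; Shimura 1998
§5.1 Props. 3, 4, 6).  This file PROVES the remaining closure properties of the étale form, for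
complex abelian varieties:

* `IsOfCMType.of_isClosedImmersion` — **every abelian subvariety `ι : B ↪ A` of a complex abelian
  variety of CM-type is of CM-type** (general `B`; this is the binder `hSub` of
  `Milne1999.hDecomp_of_hSub_of_hSimple` / `forall_cmHodgeHypothesisAt_of_codesHC_of_hSub_of_hSimple`,
  discharged here as `ComplexMultiplication.hSub_holds`): every simple abelian subvariety of `B` is a
  simple abelian subvariety of `A` (closed immersions compose), hence has `End⁰` a field of degree
  `2 dim` (`isOfCMType_of_isSimple_of_isClosedImmersion`, `IsOfCMType.isOfCMTypeSimple`), and the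
  abelian-subvariety form of the converse direction (`isOfCMType_of_forall_simple_subvariety`:
  hereditary Poincaré decomposition, products, isogeny invariance) concludes;
* `IsOfCMType.kerComponent` — in particular the identity component `(Ker φ)⁰_red` of the kernel of any
  homomorphism out of a CM abelian variety (a generalised Prym variety) is of CM-type;
* `IsOfCMType.of_surjective_hom` — **every quotient abelian variety `h : A ↠ B` (surjective
  homomorphism) of a complex abelian variety of CM-type is of CM-type**: a Poincaré complement `Z ↪ A`
  of `(Ker h)⁰_red` (`AbelianVariety.poincare_complete_reducibility`) maps onto `B`
  with `dim Z = dim B` (`dim_eq_dim_add_dim_kerComponent`, `dim_prod`), hence isogenously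
  (`isIsogeny_of_surjective_of_dim_eq`; Lange–Birkenhake Prop. 1.1.12, Cor. 2.4.24), and `Z` is of
  CM-type by the first item;
* `IsOfCMType.of_comp_eq_nsmul_id` — direct summands up to isogeny (`t ≫ h = n • 𝟙 B`, `n ≠ 0`:
  then `h` is surjective, `[n]_B` being an isogeny);
* `IsOfCMType.image_of_source` / `IsOfCMType.image_of_target` — the image of a homomorphism out of,
  resp. into, a CM abelian variety is of CM-type (`AbelianVariety.toImage` is surjective,
  `AbelianVariety.imageι` is a closed immersion; Mumford §19 p. 173);
* `IsOfCMType.of_prod_left/right`, `isOfCMType_prod_iff` — **`A × B` is of CM-type iff `A` and `B`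
  are**; `isOfCMType_biprod_iff`, `isOfCMType_powSucc_iff` (`Aⁿ⁺¹`), `isOfCMType_iff_isProductOf_and`
  / `IsOfCMType.isProductOf_and` (in a finite product, CM-type of the product is CM-type of every
  factor), `IsOfCMType.of_isIsogenous_prod_left/right` (isogeny factors);
* `isOfCMTypeSimple_of_surjective_hom` — Milne's printed clause at a simple QUOTIENT: `End⁰(B)` is a
  field of degree `2 dim B`;
* contrapositives for detecting non-CM abelian varieties (`not_isOfCMType_of_isClosedImmersion`,
  `not_isOfCMType_of_surjective_hom`, `not_isOfCMType_prod_left/right`), generalising the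
  elliptic-curve case `not_isOfCMType_prod_of_left` used on the Summits side.

No definition, no named fact: theorems only, over the tree's carriers.

## References
* [Milne1999] J. S. Milne, Compositio Math. 117 (1999), §2 p. 54 (held `paper:doi-10-1023-a-1000776613765`).
* [Milne1998CMPedestrians] J. S. Milne, arXiv:math/9806172, p. 22 (held, re-read 2026-08-21).
* [Deligne1982HodgeCycles] P. Deligne, LNM 900 (1982), §5 p. 63 and Prop. 5.1.
* [MumfordAV1970] D. Mumford, *Abelian Varieties* (1970), §19 Thm. 1, Cor. 1–2 (pp. 173–174), Remark p. 169.
* [LangeBirkenhake1992] H. Lange, Ch. Birkenhake, *Complex Abelian Varieties* (1992), Prop. 1.1.10–1.1.12,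
  Prop. 1.1.15, Cor. 2.4.24.
* [Shimura1998] G. Shimura, *Abelian Varieties with Complex Multiplication and Modular Functions* (1998),
  §5.1 Propositions 1, 3, 4, 6.
-/

noncomputable section

open CategoryTheory CategoryTheory.Limits

namespace Literature.AlgebraicGeometry.Milne1999

open _root_.AlgebraicGeometry
open Literature.AlgebraicGeometry.Motives Literature.AlgebraicGeometry.Motives.AbelianVariety
open Literature.AlgebraicGeometry.ComplexMultiplication

variable {A B C : AbelianVariety ℂ}

/-! ## §1 Abelian subvarieties -/

/-- **An abelian subvariety of a complex abelian variety of CM-type is of CM-type** (general, not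
necessarily simple, subvariety `ι : B ↪ A`; Milne 1999 p. 54 / Deligne LNM 900 §5 p. 63: CM-type is
read off the simple isogeny factors, and those of `B` are among those of `A`).  Proof in the étale
rendering: each simple abelian subvariety `i : B' ↪ B` of positive dimension is a simple abelian
subvariety `i ≫ ι : B' ↪ A` of `A`, so `End⁰(B')` is a field of degree `2 dim B'`
(`isOfCMType_of_isSimple_of_isClosedImmersion`, Shimura §5.1 Props. 3, 4, 6, and
`IsOfCMType.isOfCMTypeSimple`); conclude by `isOfCMType_of_forall_simple_subvariety` (hereditary
Poincaré decomposition of `B`, Mumford §19 Cor. 1). [cite: Milne1999, §2 p. 54]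
[cite: Deligne1982HodgeCycles, §5 p. 63 and Prop. 5.1] [cite: Shimura1998, §5.1 Propositions 3, 4, 6]
[cite: MumfordAV1970, §19 Thm. 1 and Cor. 1 (pp. 173–174)] -/
theorem IsOfCMType.of_isClosedImmersion (hA : IsOfCMType A) (ι : B ⟶ A)
    [IsClosedImmersion (AbelianVariety.Hom.toSchemeHom ι)] : IsOfCMType B :=
  isOfCMType_of_forall_simple_subvariety fun B' i hi hs hB'0 => by
    haveI := hi
    haveI : IsClosedImmersion (AbelianVariety.Hom.toSchemeHom (i ≫ ι)) := by
      rw [AbelianVariety.toSchemeHom_comp]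
      infer_instance
    exact (isOfCMType_of_isSimple_of_isClosedImmersion hA hs (i ≫ ι)).isOfCMTypeSimple hs hB'0

/-- **The identity component `(Ker φ)⁰_red` of the kernel of a homomorphism out of a complex abelian
variety of CM-type is of CM-type** (it is an abelian subvariety, `AbelianVariety.kerComponentι`;
e.g. generalised Prym varieties `(Ker Nm)⁰` inside CM Jacobians). [cite: Milne1999, §2 p. 54]
[cite: MumfordAV1970, §19 (p. 173)] -/
theorem IsOfCMType.kerComponent (hA : IsOfCMType A) (φ : A ⟶ B) :
    IsOfCMType (AbelianVariety.kerComponent φ) :=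
  hA.of_isClosedImmersion (AbelianVariety.kerComponentι φ)

/-- Contrapositive: a complex abelian variety containing an abelian subvariety that is NOT of
CM-type is not of CM-type. [cite: Milne1999, §2 p. 54] -/
theorem not_isOfCMType_of_isClosedImmersion (hB : ¬ IsOfCMType B) (ι : B ⟶ A)
    [IsClosedImmersion (AbelianVariety.Hom.toSchemeHom ι)] : ¬ IsOfCMType A :=
  fun hA => hB (hA.of_isClosedImmersion ι)

/-! ## §2 Quotient abelian varieties -/

/-- **A quotient abelian variety of a complex abelian variety of CM-type is of CM-type**: for a
surjective homomorphism `h : A ↠ B`, `B` is of CM-type if `A` is.  A Poincaré complement `j : Z ↪ A`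
of the abelian subvariety `(Ker h)⁰_red ↪ A` (`AbelianVariety.poincare_complete_reducibility`:
`((Ker h)⁰, Z) : (Ker h)⁰ ⊞ Z → A` is an isogeny) satisfies `((Ker h)⁰, Z) ≫ h = snd ≫ (j ≫ h)`, so
`j ≫ h : Z → B` is surjective; and `dim A = dim B + dim (Ker h)⁰ = dim (Ker h)⁰ + dim Z`
(`dim_eq_dim_add_dim_kerComponent`, `dim_prod`), so `dim Z = dim B` and `j ≫ h` is an isogeny
(`isIsogeny_of_surjective_of_dim_eq`; Lange–Birkenhake Prop. 1.1.12 with Cor. 2.4.24: a complement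
of `(Ker f)⁰` maps isogenously onto the image).  Now `Z` is of CM-type as an abelian subvariety of `A`
(`IsOfCMType.of_isClosedImmersion`) and `B` by isogeny invariance (`IsOfCMType.of_isIsogeny`).
[cite: Milne1999, §2 p. 54] [cite: MumfordAV1970, §19 Thm. 1 and Remark p. 169]
[cite: LangeBirkenhake1992, Prop. 1.1.12 and Cor. 2.4.24] [cite: Deligne1982HodgeCycles, §5 p. 63 and Prop. 5.1] -/
theorem IsOfCMType.of_surjective_hom (hA : IsOfCMType A) (h : A ⟶ B)
    [Surjective (AbelianVariety.Hom.toSchemeHom h)] : IsOfCMType B := by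
  obtain ⟨Z, j, hj, hσ⟩ := poincare_complete_reducibility (kerComponentι h)
  haveI := hj
  -- `((Ker h)⁰, Z) ≫ h` factors through the second projection
  have hfac : biprod.desc (kerComponentι h) j ≫ h = biprod.snd ≫ (j ≫ h) := by
    apply biprod.hom_ext' <;>
      simp only [biprod.inl_desc_assoc, biprod.inr_desc_assoc, kerComponentι_comp,
        biprod.inl_snd_assoc, biprod.inr_snd_assoc, zero_comp]
  -- hence `j ≫ h : Z ⟶ B` is surjective
  haveI hσs : Surjective (Hom.toSchemeHom (biprod.desc (kerComponentι h) j)) := hσ.1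
  haveI : Surjective (Hom.toSchemeHom (j ≫ h)) := by
    have hs : Surjective (Hom.toSchemeHom (biprod.desc (kerComponentι h) j ≫ h)) := by
      rw [AbelianVariety.toSchemeHom_comp]
      infer_instance
    rw [hfac, AbelianVariety.toSchemeHom_comp] at hs
    exact Surjective.of_comp (Hom.toSchemeHom (biprod.snd : AbelianVariety.kerComponent h ⊞ Z ⟶ Z)) _
  -- and `dim Z = dim B`
  have hdim : Z.dim = B.dim := by
    have h1 : (AbelianVariety.kerComponent h ⊞ Z).dim = A.dim := dim_eq_of_isIsogeny hσ
    have h2 : (AbelianVariety.kerComponent h ⊞ Z).dim = ((AbelianVariety.kerComponent h).prod Z).dim :=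
      dim_eq_of_isIsogeny (isIsogeny_hom_of_iso (biprodIsoProd (AbelianVariety.kerComponent h) Z))
    have h3 := dim_prod (AbelianVariety.kerComponent h) Z
    have h4 := dim_eq_dim_add_dim_kerComponent h
    omega
  -- so `j ≫ h` is an isogeny from an abelian subvariety of `A` onto `B`
  exact (hA.of_isClosedImmersion j).of_isIsogeny (isIsogeny_of_surjective_of_dim_eq (j ≫ h) hdim)

/-- The binder form for quotients: for every surjective homomorphism `h : A ⟶ B` of complex abelian
varieties, `IsOfCMType A → IsOfCMType B`. [cite: Milne1999, §2 p. 54]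
[cite: MumfordAV1970, §19 Thm. 1 and Remark p. 169] -/
theorem isOfCMType_of_surjective_hom (h : A ⟶ B) (hh : Surjective (AbelianVariety.Hom.toSchemeHom h))
    (hA : IsOfCMType A) : IsOfCMType B := by
  haveI := hh
  exact hA.of_surjective_hom h

/-- Contrapositive: a complex abelian variety with a quotient abelian variety that is NOT of CM-type
is not of CM-type. [cite: Milne1999, §2 p. 54] -/
theorem not_isOfCMType_of_surjective_hom (hB : ¬ IsOfCMType B) (h : A ⟶ B)
    [Surjective (AbelianVariety.Hom.toSchemeHom h)] : ¬ IsOfCMType A :=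
  fun hA => hB (hA.of_surjective_hom h)

/-- **Milne's printed clause at a simple quotient**: if `A` is of CM-type and `h : A ↠ B` is a
surjective homomorphism onto a SIMPLE abelian variety of positive dimension, then `End⁰(B)` is a
field of degree `2 dim B` over `ℚ` (`IsOfCMType.of_surjective_hom`, `IsOfCMType.isOfCMTypeSimple`).
[cite: Milne1999, §2 p. 54] [cite: Shimura1998, §5.1 Propositions 3, 4, 6] -/
theorem isOfCMTypeSimple_of_surjective_hom (hA : IsOfCMType A) (h : A ⟶ B)
    [Surjective (AbelianVariety.Hom.toSchemeHom h)] (hB : AbelianVariety.IsSimple B) (hB0 : 0 < B.dim) :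
    IsOfCMTypeSimple B :=
  (hA.of_surjective_hom h).isOfCMTypeSimple hB hB0

/-! ## §3 Direct summands up to isogeny and images -/

/-- If `t ≫ h = n • 𝟙 B` with `n ≠ 0` then `h` is surjective on underlying schemes (`[n]_B` is an
isogeny, `isIsogeny_zsmul_id_of_cast_ne_zero`, in particular surjective).
[cite: MumfordAV1970, §19 Remark p. 169] -/
theorem surjective_toSchemeHom_of_comp_eq_nsmul_id (t : B ⟶ A) (h : A ⟶ B) {n : ℕ} (hn : n ≠ 0)
    (hth : t ≫ h = n • 𝟙 B) : Surjective (AbelianVariety.Hom.toSchemeHom h) := by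
  have hs : Surjective (AbelianVariety.Hom.toSchemeHom (n • 𝟙 B)) := by
    have hz := isIsogeny_zsmul_id_of_cast_ne_zero (A := B) (n : ℤ)
      (by rw [Int.cast_natCast]; exact Nat.cast_ne_zero.mpr hn)
    rw [natCast_zsmul] at hz
    exact hz.1
  rw [← hth, AbelianVariety.toSchemeHom_comp] at hs
  exact Surjective.of_comp (AbelianVariety.Hom.toSchemeHom t) _

/-- **CM-type passes to direct summands up to isogeny**: if `t : B → A`, `h : A → B` satisfy
`t ≫ h = n • 𝟙 B` with `n ≠ 0` («`B` is a direct summand of `A` up to isogeny» — the shape in which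
Poincaré reducibility is consumed by `HodgeTheory.HodgeConjectureFor.of_comp_eq_nsmul_id`) and `A` is
of CM-type, then `B` is of CM-type (`h` is surjective; `IsOfCMType.of_surjective_hom`).
[cite: Milne1999, §2 p. 54] [cite: MumfordAV1970, §19 Thm. 1 and Remark p. 169] -/
theorem IsOfCMType.of_comp_eq_nsmul_id (hA : IsOfCMType A) (t : B ⟶ A) (h : A ⟶ B) {n : ℕ}
    (hn : n ≠ 0) (hth : t ≫ h = n • 𝟙 B) : IsOfCMType B := by
  haveI := surjective_toSchemeHom_of_comp_eq_nsmul_id t h hn hth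
  exact hA.of_surjective_hom h

/-- Split form (`n = 1`): a retract `t ≫ h = 𝟙 B` of a complex abelian variety of CM-type is of
CM-type. [cite: Milne1999, §2 p. 54] -/
theorem IsOfCMType.of_comp_eq_id (hA : IsOfCMType A) (t : B ⟶ A) (h : A ⟶ B) (hth : t ≫ h = 𝟙 B) :
    IsOfCMType B :=
  hA.of_comp_eq_nsmul_id t h one_ne_zero (by rw [hth, one_smul])

/-- **The image of a homomorphism OUT OF a complex abelian variety of CM-type is of CM-type**
(`A ↠ im g` is a surjective homomorphism, `AbelianVariety.toImage`; Mumford §19 p. 173: images of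
homomorphisms are abelian subvarieties). [cite: MumfordAV1970, §19 (p. 173)] [cite: Milne1999, §2 p. 54] -/
theorem IsOfCMType.image_of_source (hA : IsOfCMType A) (g : A ⟶ B) :
    IsOfCMType (AbelianVariety.image g) :=
  hA.of_surjective_hom (AbelianVariety.toImage g)

/-- **The image of a homomorphism INTO a complex abelian variety of CM-type is of CM-type**
(`im g ↪ B` is an abelian subvariety, `AbelianVariety.imageι`). [cite: MumfordAV1970, §19 (p. 173)]
[cite: Milne1999, §2 p. 54] -/
theorem IsOfCMType.image_of_target (hB : IsOfCMType B) (g : A ⟶ B) :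
    IsOfCMType (AbelianVariety.image g) :=
  hB.of_isClosedImmersion (AbelianVariety.imageι g)

/-! ## §4 Products -/

/-- The inclusion `B → A × B`, `b ↦ (0, b)`, is a closed immersion (it is split by `snd`; companion
of the tree's `AbelianVariety.isClosedImmersion_prodLift_id_zero`). [folklore] -/
private theorem isClosedImmersion_prodLift_zero_id (A B : AbelianVariety ℂ) :
    IsClosedImmersion (AbelianVariety.Hom.toSchemeHom (prodLift (0 : B ⟶ A) (𝟙 B))) :=
  isClosedImmersion_of_comp_eq_id _ (AbelianVariety.snd A B) (prodLift_snd _ _)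

/-- **The first factor of a product of CM-type is of CM-type** (`(𝟙, 0) : A ↪ A × B` is an abelian
subvariety). [cite: Milne1999, §2 p. 54] [cite: Deligne1982HodgeCycles, §5 p. 63] -/
theorem IsOfCMType.of_prod_left (h : IsOfCMType (A.prod B)) : IsOfCMType A := by
  haveI := isClosedImmersion_prodLift_id_zero A B
  exact h.of_isClosedImmersion (prodLift (𝟙 A) (0 : A ⟶ B))

/-- **The second factor of a product of CM-type is of CM-type** (`(0, 𝟙) : B ↪ A × B`).
[cite: Milne1999, §2 p. 54] [cite: Deligne1982HodgeCycles, §5 p. 63] -/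
theorem IsOfCMType.of_prod_right (h : IsOfCMType (A.prod B)) : IsOfCMType B := by
  haveI := isClosedImmersion_prodLift_zero_id A B
  exact h.of_isClosedImmersion (prodLift (0 : B ⟶ A) (𝟙 B))

/-- **`A × B` is of CM-type if and only if `A` and `B` are** (Deligne LNM 900 §5 p. 63: «`A` is of
CM-type if and only if each `A_α` is of CM-type»; `⇐` is the tree's `IsOfCMType.prod`).
[cite: Deligne1982HodgeCycles, §5 p. 63] [cite: Milne1999, §2 p. 54] -/
theorem isOfCMType_prod_iff : IsOfCMType (A.prod B) ↔ IsOfCMType A ∧ IsOfCMType B :=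
  ⟨fun h => ⟨h.of_prod_left, h.of_prod_right⟩, fun h => h.1.prod h.2⟩

/-- The same for the categorical biproduct `A ⊞ B` (isomorphic, hence isogenous, to `A × B`).
[cite: Deligne1982HodgeCycles, §5 p. 63] -/
theorem isOfCMType_biprod_iff : IsOfCMType (A ⊞ B) ↔ IsOfCMType A ∧ IsOfCMType B := by
  rw [← isOfCMType_prod_iff]
  exact isOfCMType_iff_of_isIsogenous ⟨_, isIsogeny_hom_of_iso (biprodIsoProd A B)⟩

/-- Contrapositive, first factor: `A × B` is not of CM-type if `A` is not (any dimensions; the case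
`dim A = 1` is the Summits-side `not_isOfCMType_prod_of_left`). [cite: Milne1999, §2 p. 54] -/
theorem not_isOfCMType_prod_left (hA : ¬ IsOfCMType A) : ¬ IsOfCMType (A.prod B) :=
  fun h => hA h.of_prod_left

/-- Contrapositive, second factor: `A × B` is not of CM-type if `B` is not. [cite: Milne1999, §2 p. 54] -/
theorem not_isOfCMType_prod_right (hB : ¬ IsOfCMType B) : ¬ IsOfCMType (A.prod B) :=
  fun h => hB h.of_prod_right

/-- **Isogeny factors**: if `A` is of CM-type and isogenous to `B × C` then `B` is of CM-type
(isogeny invariance and `IsOfCMType.of_prod_left`; this is the «simple isogeny factor» clause of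
Milne's definition without the simplicity). [cite: Milne1999, §2 p. 54]
[cite: MumfordAV1970, §19 Thm. 1 Cor. 1 (pp. 173–174)] -/
theorem IsOfCMType.of_isIsogenous_prod_left (hA : IsOfCMType A)
    (h : AbelianVariety.IsIsogenous A (B.prod C)) : IsOfCMType B :=
  ((isOfCMType_iff_of_isIsogenous h).1 hA).of_prod_left

/-- **Isogeny factors**, second factor: if `A` is of CM-type and isogenous to `B × C` then `C` is
of CM-type. [cite: Milne1999, §2 p. 54] [cite: MumfordAV1970, §19 Thm. 1 Cor. 1 (pp. 173–174)] -/
theorem IsOfCMType.of_isIsogenous_prod_right (hA : IsOfCMType A)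
    (h : AbelianVariety.IsIsogenous A (B.prod C)) : IsOfCMType C :=
  ((isOfCMType_iff_of_isIsogenous h).1 hA).of_prod_right

/-- **Powers**: `Aⁿ⁺¹` (`AbelianVariety.powSucc`) is of CM-type iff `A` is.
[cite: Milne1999, §2 p. 54] [cite: Deligne1982HodgeCycles, §5 p. 63] -/
theorem isOfCMType_powSucc_iff (n : ℕ) : IsOfCMType (A.powSucc n) ↔ IsOfCMType A := by
  induction n with
  | zero => rfl
  | succ n ih => rw [AbelianVariety.powSucc_succ, isOfCMType_prod_iff, ih, and_self_iff]

/-- **Finite products**: a finite product (`AbelianVariety.IsProductOf Q`) all of whose factors are of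
CM-type is of CM-type (induction on the product, `IsOfCMType.prod`).
[cite: Deligne1982HodgeCycles, §5 p. 63] [cite: Milne1999, §2 p. 54] -/
theorem isOfCMType_of_isProductOf {Q : AbelianVariety ℂ → Prop} {P : AbelianVariety ℂ}
    (hP : AbelianVariety.IsProductOf Q P) (hQ : ∀ X, Q X → IsOfCMType X) : IsOfCMType P := by
  induction hP with
  | atom h => exact hQ _ h
  | prod _ _ ih₁ ih₂ => exact ih₁.prod ih₂

/-- **Finite products, converse**: if a finite product of abelian varieties with property `Q` is of
CM-type, then it is a finite product of abelian varieties with property `Q` that are OF CM-TYPE —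
every factor is of CM-type (`IsOfCMType.of_prod_left/right` down the product).
[cite: Deligne1982HodgeCycles, §5 p. 63] [cite: Milne1999, §2 p. 54] -/
theorem IsOfCMType.isProductOf_and {Q : AbelianVariety ℂ → Prop} {P : AbelianVariety ℂ}
    (hP : AbelianVariety.IsProductOf Q P) (hCM : IsOfCMType P) :
    AbelianVariety.IsProductOf (fun X => Q X ∧ IsOfCMType X) P := by
  induction hP with
  | atom hQ => exact .atom ⟨hQ, hCM⟩
  | prod _ _ ih₁ ih₂ => exact .prod (ih₁ hCM.of_prod_left) (ih₂ hCM.of_prod_right)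

/-- **A finite product is of CM-type iff every factor is** (Deligne LNM 900 §5 p. 63), in the
`IsProductOf` rendering: `P` is of CM-type iff `P` is a finite product of factors with property `Q`
each of which is of CM-type. [cite: Deligne1982HodgeCycles, §5 p. 63] [cite: Milne1999, §2 p. 54] -/
theorem isOfCMType_iff_isProductOf_and {Q : AbelianVariety ℂ → Prop} {P : AbelianVariety ℂ}
    (hP : AbelianVariety.IsProductOf Q P) :
    IsOfCMType P ↔ AbelianVariety.IsProductOf (fun X => Q X ∧ IsOfCMType X) P :=
  ⟨fun h => h.isProductOf_and hP, fun h => isOfCMType_of_isProductOf h fun _ hX => hX.2⟩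

end Literature.AlgebraicGeometry.Milne1999

/-! ## §5 The binder `hSub` of the Milne 1999 chain, discharged -/

namespace Literature.AlgebraicGeometry.ComplexMultiplication

open _root_.AlgebraicGeometry
open Literature.AlgebraicGeometry.Motives Literature.AlgebraicGeometry.Milne1999

/-- **The binder `hSub` («abelian subvarieties of complex CM abelian varieties are CM») of
`Milne1999.hDecomp_of_hSub_of_hSimple` and
`Milne1999.forall_cmHodgeHypothesisAt_of_codesHC_of_hSub_of_hSimple`, DISCHARGED for all abelian
subvarieties** (the tree's `hSub_simple` discharged it at simple ones): plug `hSub_holds` for `hSub`;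
the resulting one-binder forms are the tree's `Milne1999.hDecomp_of_hSimple` /
`forall_cmHodgeHypothesisAt_of_codesHC_of_hSimple` (same statements, reached there via `hSub_simple`).
[cite: Milne1999, §2 p. 54] [cite: Deligne1982HodgeCycles, §5 p. 63 and Prop. 5.1]
[cite: Milne1998CMPedestrians, p. 22] -/
theorem hSub_holds : ∀ (A B : AbelianVariety ℂ) (f : B ⟶ A),
    IsClosedImmersion (AbelianVariety.Hom.toSchemeHom f) → IsOfCMType A → IsOfCMType B :=
  fun _ _ f hf hA => by
    haveI := hf
    exact hA.of_isClosedImmersion f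

end Literature.AlgebraicGeometry.ComplexMultiplication
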